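import Literature.NumberTheory.Automorphic.FiniteLengthOfLevelGL
import Literature.NumberTheory.Automorphic.ParabolicGLReindex
import Literature.NumberTheory.Automorphic.ParabolicIndGLFiniteGeneration
import Literature.NumberTheory.Automorphic.ParabolicIndGLFiniteLengthReduction
import HarnessLib

/-!
# Parabolic induction preserves finite length on `GL_n(F)`: proof of `isFiniteLength_parabolicIndGL`

This file discharges the named fact `Representation.isFiniteLength_parabolicIndGL`
(`ParabolicGL`; Bernstein–Zelevinsky 1977, Thm. 2.8 with Remark 2.10, p. 448; Zelevinsky 1980,
Prop. 1.4, p. 171): *for an admissible representation `σ` of finite length of the standard Levi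
`Π_a GL_{n_a}(F)`, the induced representation `i_c σ` of `GL_n(F)` has finite length.*

## Proof (Bernstein–Zelevinsky 1976, §3; 1977, §2)

1. By exactness of `i_c` it suffices to treat irreducible admissible `σ`
   (`Representation.isFiniteLength_parabolicIndGL_of_forall_irreducible`).
2. The statement is invariant under reindexing `n` and relabelling the blocks
   (`isFiniteLength_parabolicIndGL_iff_reindex`), so we may assume `c : Fin N → Fin r` monotone.
3. Then `i_c σ` is finitely generated (`finite_asModule_parabolicIndGL_of_isIrreducible`, the
   big-cell construction), admissible (`isAdmissible_parabolicIndGL_holds`), and its generators are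
   fixed by a common principal congruence subgroup (`exists_level_generators`).
4. An admissible representation of `GL_n(F)` generated by vectors of bounded level has finite
   length (`isFiniteLength_of_isAdmissible_of_span_eq_top`: uniform level of the cuspidal
   constituents via Jacquet modules, compactness of cuspidal representations on `L°`, duality).

Theorems only; no new definitions or named facts.

## References

* I. N. Bernstein, A. V. Zelevinsky, *Induced representations of reductive `p`-adic groups I*,
  Ann. Sci. ÉNS 10 (1977), Thm. 2.8, Remark 2.10 (p. 448).
* A. V. Zelevinsky, *Induced representations of reductive `p`-adic groups II*, Ann. Sci. ÉNS 13
  (1980), Prop. 1.4 (p. 171).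
* I. N. Bernstein, A. V. Zelevinsky, Russian Math. Surveys 31:3 (1976), §3, Thm. 4.1.
-/

noncomputable section

open scoped MatrixGroups Pointwise

namespace Literature.NumberTheory.Automorphic

open Representation ValuativeRel

variable (F : Type*) [Field F] [ValuativeRel F] [TopologicalSpace F] [IsNonarchimedeanLocalField F]

/-- **Generators of a common level.** A finitely generated smooth representation `π` of `GL_N(F)`
is spanned by the translates of a finite set of vectors fixed by one principal congruence
subgroup `K_{|ϖ|^{j₀+1}}` (every vector is fixed by some `K_j`, and the `K_j` decrease).
[folklore] -/
theorem exists_level_generators {N r : ℕ} {c : Fin N → Fin r} (hc : Monotone c) {V : Type*} [AddCommGroup V] [Module ℂ V]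
    (π : Representation ℂ (GL (Fin N) F) V) (hπ : π.IsSmooth)
    [Module.Finite (MonoidAlgebra ℂ (GL (Fin N) F)) π.asModule] {ϖ : F} (hϖ0 : valuation F ϖ ≠ 0)
    (hϖ1 : valuation F ϖ < 1) :
    ∃ (j₀ : ℕ) (s : Set V), s ⊆ π.fixedPoints (congruenceGL N (valuation F ϖ ^ (j₀ + 1))) ∧
      Submodule.span ℂ {w | ∃ g : GL (Fin N) F, ∃ f ∈ s, w = π g f} = ⊤ := by
  classical
  haveI : IsTopologicalRing F := inferInstance
  obtain ⟨S, hS⟩ := (Module.Finite.fg_top : (⊤ : Submodule (MonoidAlgebra ℂ (GL (Fin N) F)) π.asModule).FG)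
  -- the generators, viewed in `V`, and a common level
  let s : Set V := Set.range fun x : (S : Set π.asModule) => π.asModuleEquiv (x : π.asModule)
  have hlev : ∀ f : V, ∃ j : ℕ, f ∈ π.fixedPoints (congruenceGL N (valuation F ϖ ^ (j + 1))) := by
    intro f
    obtain ⟨j, hj⟩ := (bigCellDatumGL hc hϖ0 hϖ1).exists_K_subset _ ((hπ f).mem_nhds (Subgroup.one_mem _))
    refine ⟨j, (mem_fixedPoints _ _ _).2 fun g hg => ?_⟩
    exact hj (by simpa using hg)
  choose lev hlev using hlev
  refine ⟨S.sup fun x => lev (π.asModuleEquiv x), s, fun f hf => ?_, ?_⟩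
  · -- `K_{j₀} ≤ K_{lev f}`
    obtain ⟨⟨x, hx⟩, rfl⟩ := hf
    have hle : lev (π.asModuleEquiv x) ≤ S.sup fun x => lev (π.asModuleEquiv x) :=
      Finset.le_sup (f := fun x => lev (π.asModuleEquiv x)) hx
    refine (mem_fixedPoints _ _ _).2 fun g hg => (mem_fixedPoints _ _ _).1 (hlev _) g ?_
    exact congruenceGL_mono (pow_le_pow_right_of_le_one' hϖ1.le (Nat.succ_le_succ hle)) hg
  · -- the span of the translates is a subrepresentation containing the `ℂ[G]`-span of `S`
    let T : Subrepresentation π :=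
      ⟨Submodule.span ℂ {w | ∃ g : GL (Fin N) F, ∃ f ∈ s, w = π g f}, fun g w hw => by
        refine Submodule.span_induction ?_ ?_ ?_ ?_ hw
        · rintro _ ⟨g', f, hf, rfl⟩
          exact Submodule.subset_span ⟨g * g', f, hf, by rw [map_mul, Module.End.mul_apply]⟩
        · rw [map_zero]; exact Submodule.zero_mem _
        · intro a b _ _ ha hb; rw [map_add]; exact Submodule.add_mem _ ha hb
        · intro r a _ ha; rw [map_smul]; exact Submodule.smul_mem _ r ha⟩
    have hST : (S : Set π.asModule) ⊆ (T.asSubmodule : Set π.asModule) := fun x hx =>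
      (Subrepresentation.mem_asSubmodule_iff).2
        (Submodule.subset_span ⟨1, π.asModuleEquiv x, ⟨⟨x, hx⟩, rfl⟩, by rw [map_one]; rfl⟩)
    have htop : (⊤ : Submodule (MonoidAlgebra ℂ (GL (Fin N) F)) π.asModule) ≤ T.asSubmodule := by
      rw [← hS]; exact Submodule.span_le.2 hST
    refine eq_top_iff.2 fun v _ => ?_
    have hv : π.asModuleEquiv.symm v ∈ T.asSubmodule := htop Submodule.mem_top
    exact hv

/-- **`i_c ω` has finite length for `ω` irreducible admissible and `c : Fin N → Fin r` monotone.**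
[cite: BernsteinZelevinsky1977, Thm. 2.8 and Remark 2.10] -/
theorem isFiniteLength_parabolicIndGL_of_isIrreducible_fin {N r : ℕ} {c : Fin N → Fin r} (hc : Monotone c)
    {W : Type*} [AddCommGroup W] [Module ℂ W] (ω : Representation ℂ (Π a, GL {i // c i = a} F) W) [ω.IsIrreducible]
    (hω : ω.IsAdmissible) : IsFiniteLength (MonoidAlgebra ℂ (GL (Fin N) F)) (parabolicIndGL F c ω).asModule := by
  haveI : IsTopologicalRing F := inferInstance
  obtain ⟨ϖ, hϖ0, hϖ1⟩ := exists_valuation_pos_lt_one (F := F)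
  haveI := finite_asModule_parabolicIndGL_of_isIrreducible (F := F) hc ω hω
  have hadm : (parabolicIndGL F c ω).IsAdmissible := isAdmissible_parabolicIndGL_holds F c ω hω
  obtain ⟨j₀, s, hsK, hgen⟩ := exists_level_generators F hc (parabolicIndGL F c ω) hadm.isSmooth hϖ0 hϖ1
  exact isFiniteLength_of_isAdmissible_of_span_eq_top _ hadm hϖ0 hϖ1 j₀ hsK hgen

/-- **`i_c ω` has finite length for `ω` irreducible admissible** (any finite index type `n`, any
block labelling `c : n → α`): reduce to a monotone labelling of `Fin N` by
`exists_monotone_relabelling` and `isFiniteLength_parabolicIndGL_iff_reindex`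
(`ω ∘ Θ` is again irreducible and admissible). [cite: BernsteinZelevinsky1977, Thm. 2.8 and Remark 2.10] -/
theorem isFiniteLength_parabolicIndGL_of_isIrreducible' {n : Type*} [Fintype n] [DecidableEq n] {α : Type*}
    [LinearOrder α] [Fintype α] (c : n → α) {W : Type*} [AddCommGroup W] [Module ℂ W]
    (ω : Representation ℂ (Π a, GL {i // c i = a} F) W) [ω.IsIrreducible] (hω : ω.IsAdmissible) :
    IsFiniteLength (MonoidAlgebra ℂ (GL n F)) (parabolicIndGL F c ω).asModule := by
  obtain ⟨N, r, e, c'', hmono, hcc⟩ := exists_monotone_relabelling c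
  rw [← isFiniteLength_parabolicIndGL_iff_reindex F c e c'' hcc ω]
  haveI : IsIrreducible (ω.comp (leviReindexHom F c e c'' hcc)) :=
    isIrreducible_comp_of_surjective ω _ (leviReindexHom_surjective F c e c'' hcc)
  exact isFiniteLength_parabolicIndGL_of_isIrreducible_fin F hmono _
    (IsAdmissible.comp_of_isOpenMap ω _ (continuous_leviReindexHom F c e c'' hcc)
      (isOpenMap_leviReindexHom F c e c'' hcc) hω)

end Literature.NumberTheory.Automorphic

/-! ### The discharge -/

namespace Representation

open Literature.NumberTheory.Automorphic

variable (F : Type*) [Field F] [ValuativeRel F] [TopologicalSpace F] [IsNonarchimedeanLocalField F]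
  {n : Type*} [Fintype n] [DecidableEq n] {α : Type*} [LinearOrder α] [Fintype α] (c : n → α)

/-- **Parabolic induction preserves finite length on `GL_n(F)`** (discharge of
`Representation.isFiniteLength_parabolicIndGL`; Bernstein–Zelevinsky 1977, Thm. 2.8 and Remark
2.10, p. 448: "if `ρ` is admissible of finite length then so is `i_{G,M}(ρ)`"; Zelevinsky 1980,
Prop. 1.4, p. 171). Proof as in the module docstring. [cite: BernsteinZelevinsky1977, Thm. 2.8 and Remark 2.10] -/
theorem isFiniteLength_parabolicIndGL_holds : isFiniteLength_parabolicIndGL F c :=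
  isFiniteLength_parabolicIndGL_of_forall_irreducible F c fun ω hirr hω => by
    haveI := hirr
    exact isFiniteLength_parabolicIndGL_of_isIrreducible' F c ω hω

end Representation
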